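import Summits.HodgeConjecture.CorCM.Census.QuaternionColumnCircle

/-!
# The quaternion column, III: the interior chains — every single flip of `T₀ = barc 0 0` reduces with exponent one

COR-CM (cell `pub-hodgecm2`), count-neutral kernel combinatorics by the binder seat b09 (gen 39; lane QUATERNION COLUMN), part III, on
parts I `Census/QuaternionColumnBiarc.lean` (biarcs, flips, `rt_a_barc`) and II `Census/QuaternionColumnCircle.lean`
(`two_smul_single_barc_mem_target`: the biarc circle closes with exponent one), with `BlockParity.rt_oflipCM`,
`BlockParity.oflipCM_oflipCM_comm/self`, part J `Nondegenerate.smul_single_rt_mem_target` and part M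
`BaseBlock.residual_reduction_of_single_flips` used BY NAME.  Theorems only: no definition, no `decide`, no certificate, no named fact, no `sorry`.
HONEST FRAMING: `HC_CM` is NOT proved, here or anywhere in the tree; nothing here is a period or a headline.

THE CHAINS (numerics `HOME/pub-hodgecm2-b09/lean-g39/py2/qplan.py`: plan S, `n = 4, 8, 16`).  `T₀ = barc 0 0` has `2n` single flips: the four
arc ends `T₀^{(a 0)} = barc 1 0`, `T₀^{(a (n−1))} = barc (−1) 0`, `T₀^{(xa 0)} = barc 0 1`, `T₀^{(xa (n−1))} = barc 0 (−1)` are biarcs (part II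
reduces them), the `2(n−2)` INTERIOR flips `U_i = T₀^{(a i)}`, `V_j = T₀^{(xa j)}` (`1 ≤ i, j ≤ n−2`) are not.  The base change along `a 1`
costs exactly the two places `a (−1)`, `xa (−1)`: `T₀·(a 1)⁻¹ = T₀^{(a(−1))(xa(−1))}` (§1), whence the COINCIDENCES
`T₀^{(a 0)}·(a 1)⁻¹ = T₀^{(xa (−1))}`, `T₀^{(a 0)(a (i+1))}·(a 1)⁻¹ = T₀^{(a i)(xa (−1))}`, `T₀^{(a 0)(xa (j+1))}·(a 1)⁻¹ = T₀^{(xa j)(xa(−1))}`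
(`rt_a_one_oflip_a_zero`, `rt_a_one_oflip_a_zero_a`, `rt_a_one_oflip_a_zero_xa`).  Consequently the two faces at `T₀`
`f_i = gface T₀ (a i) (xa (−1))` and `c_i = gface T₀ (a 0) (a (i+1))` differ, after base-changing `c_i` along `a 1`, by
`[U_i] − [U_{i+1}·(a 1)⁻¹] + ([T₀·(a 1)⁻¹] − [T₀])` (`chain_identity_a`) — a UNIT relation `[U_i] ≡ [U_{i+1}·(a 1)⁻¹]` modulo the target
lattice; the chain ends at the biarc `U_{n−1} = barc (−1) 0`.  Likewise `f'_j = gface T₀ (xa j) (xa (−1))`, `c'_j = gface T₀ (a 0) (xa (j+1))`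
give `[V_j] ≡ [V_{j+1}·(a 1)⁻¹]`, the chain ending at `V_{n−2}` whose face `f'_{n−2}` has only biarc corners besides `V_{n−2}`
(`T₀`, `barc 0 (−1)`, `barc 0 (−2)`).

**THEOREM (`residual_reduction_quaternion`).**  For every finite `S` containing the biarc faces `fplus k 0` (`k < n`), the chain faces
`f_i, c_i` (`1 ≤ i ≤ n−2`), `f'_j` (`1 ≤ j ≤ n−2`) and `c'_j` (`1 ≤ j ≤ n−3`): every type of potential `≤ 1` w.r.t. `T₀ = barc 0 0` satisfies
`2·[Ψ] ∈ ℤ⟨pairs⟩ + ℤ⟨base changes of S⟩ + ℤ⟨base changes of [T₀]⟩` — the hypothesis `hres` (with `k = 1`) of the META-THEOREM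
`Splitting.isLeast_card_gfaces_generate_of_residual_reduction` for the quaternion column, uniformly in `n ≥ 1`.

## References
* [Pohlmann1968] H. Pohlmann, Algebraic cycles on abelian varieties of complex multiplication type, Ann. of Math. 88 (1968), Thm 1.
-/

namespace Summit.HodgeConjecture.CorCM.Census.QuaternionColumn

open Finset QuaternionGroup
open Summit.HodgeConjecture.CorCM.Prior.AllgGroup.RfwfAllgGroup
open Summit.HodgeConjecture.CorCM.Census.BlockParity
open Summit.HodgeConjecture.CorCM.Census.Coinvariant
open Summit.HodgeConjecture.CorCM.Census.Nondegenerate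
open Summit.HodgeConjecture.CorCM.Census.BaseBlock
open Summit.HodgeConjecture.CorCM.Census.TwistGeneration

noncomputable section

variable {n : ℕ} [NeZero n]

/-! ## §1 The base change along `a 1` and its three coincidences -/

/-- The four arc-end flips of `T₀ = barc 0 0` are biarcs. [folklore] -/
theorem oflipCM_ends :
    oflipCM (c n) c_mul_c (a 0) (barc (0 : ZMod (2 * n)) 0) = barc 1 0 ∧
      oflipCM (c n) c_mul_c (a (-1)) (barc (0 : ZMod (2 * n)) 0) = barc (-1) 0 ∧
        oflipCM (c n) c_mul_c (xa 0) (barc (0 : ZMod (2 * n)) 0) = barc 0 1 ∧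
          oflipCM (c n) c_mul_c (xa (-1)) (barc (0 : ZMod (2 * n)) 0) = barc 0 (-1) := by
  refine ⟨by rw [oflipCM_a_barc, zero_add], ?_, by rw [oflipCM_xa_barc, zero_add], ?_⟩
  · have h := oflipCM_a_last_barc (n := n) 0 0; rwa [zero_sub] at h
  · have h := oflipCM_xa_last_barc (n := n) 0 0; rwa [zero_sub] at h

/-- **The base change along `a 1` costs the two places `a (−1)`, `xa (−1)`**: `T₀·(a 1)⁻¹ = barc (−1) (−1) = T₀^{(a(−1))(xa(−1))}`. [folklore] -/
theorem rt_a_one_base : rt (c n) (a 1) (barc (0 : ZMod (2 * n)) 0) =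
    oflipCM (c n) c_mul_c (a (-1)) (oflipCM (c n) c_mul_c (xa (-1)) (barc 0 0)) := by
  rw [oflipCM_ends.2.2.2, rt_a_barc, zero_sub]
  have h := oflipCM_a_last_barc (n := n) 0 (-1)
  rw [zero_sub] at h
  exact h.symm

/-- Base change along `a 1` of a flip: `Ψ^{(t)}·(a 1)⁻¹ = (Ψ·(a 1)⁻¹)^{(t·a(−1))}`. [folklore] -/
theorem rt_a_one_oflipCM (t : QuaternionGroup n) (Ψ : CMF (QuaternionGroup n) (c n)) :
    rt (c n) (a 1) (oflipCM (c n) c_mul_c t Ψ) = oflipCM (c n) c_mul_c (t * a (-1)) (rt (c n) (a 1) Ψ) :=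
  rt_oflipCM (c n) c_mul_c (a 1) t Ψ

/-- **Coincidence 1**: `T₀^{(a 0)}·(a 1)⁻¹ = T₀^{(xa (−1))}` (the two single flips of the block `E₊`). [folklore] -/
theorem rt_a_one_oflip_a_zero : rt (c n) (a 1) (oflipCM (c n) c_mul_c (a 0) (barc (0 : ZMod (2 * n)) 0)) =
    oflipCM (c n) c_mul_c (xa (-1)) (barc 0 0) := by
  rw [oflipCM_ends.1, oflipCM_ends.2.2.2, rt_a_barc, sub_self, zero_sub]

/-- **Coincidence 2**: `T₀^{(a 0)(a (i+1))}·(a 1)⁻¹ = T₀^{(a i)(xa (−1))}`. [folklore] -/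
theorem rt_a_one_oflip_a_zero_a (i : ZMod (2 * n)) :
    rt (c n) (a 1) (oflipCM (c n) c_mul_c (a 0) (oflipCM (c n) c_mul_c (a (i + 1)) (barc (0 : ZMod (2 * n)) 0))) =
      oflipCM (c n) c_mul_c (a i) (oflipCM (c n) c_mul_c (xa (-1)) (barc 0 0)) := by
  rw [rt_a_one_oflipCM, rt_a_one_oflipCM, rt_a_one_base, a_mul_a, a_mul_a, zero_add, show i + 1 + -1 = i by ring,
    oflipCM_oflipCM_comm (c n) c_mul_c (a (-1)) (a i), oflipCM_oflipCM_self]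

/-- **Coincidence 3**: `T₀^{(a 0)(xa (j+1))}·(a 1)⁻¹ = T₀^{(xa j)(xa (−1))}`. [folklore] -/
theorem rt_a_one_oflip_a_zero_xa (j : ZMod (2 * n)) :
    rt (c n) (a 1) (oflipCM (c n) c_mul_c (a 0) (oflipCM (c n) c_mul_c (xa (j + 1)) (barc (0 : ZMod (2 * n)) 0))) =
      oflipCM (c n) c_mul_c (xa j) (oflipCM (c n) c_mul_c (xa (-1)) (barc 0 0)) := by
  rw [rt_a_one_oflipCM, rt_a_one_oflipCM, rt_a_one_base, a_mul_a, xa_mul_a, zero_add, show j + 1 + -1 = j by ring,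
    oflipCM_oflipCM_comm (c n) c_mul_c (a (-1)) (xa j), oflipCM_oflipCM_self]

/-! ## §2 The chain identities -/

/-- **The rotation chain identity**: `[U_i] − [U_{i+1}·(a 1)⁻¹] = ([T₀] − [T₀·(a 1)⁻¹]) − f_i + c_i·(a 1)⁻¹` in `ℤ[types]`, with
`U_i = T₀^{(a i)}`, `f_i = gface T₀ (a i) (xa (−1))`, `c_i = gface T₀ (a 0) (a (i+1))`. [folklore] -/
theorem chain_identity_a (i : ZMod (2 * n)) :
    Finsupp.single (oflipCM (c n) c_mul_c (a i) (barc (0 : ZMod (2 * n)) 0)) (1 : ℤ) -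
        Finsupp.single (rt (c n) (a 1) (oflipCM (c n) c_mul_c (a (i + 1)) (barc 0 0))) 1 =
      (Finsupp.single (barc (0 : ZMod (2 * n)) 0) (1 : ℤ) - Finsupp.single (rt (c n) (a 1) (barc 0 0)) 1) -
        gface (c n) c_mul_c (barc 0 0) (a i) (xa (-1)) +
          Finsupp.mapDomain (rt (c n) (a 1)) (gface (c n) c_mul_c (barc 0 0) (a 0) (a (i + 1))) := by
  rw [gface, gface]
  simp only [Finsupp.mapDomain_add, Finsupp.mapDomain_sub, Finsupp.mapDomain_single]
  rw [rt_a_one_oflip_a_zero_a, rt_a_one_oflip_a_zero]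
  abel

/-- **The reflection chain identity**: `[V_j] − [V_{j+1}·(a 1)⁻¹] = ([T₀] − [T₀·(a 1)⁻¹]) − f'_j + c'_j·(a 1)⁻¹`, with
`V_j = T₀^{(xa j)}`, `f'_j = gface T₀ (xa j) (xa (−1))`, `c'_j = gface T₀ (a 0) (xa (j+1))`. [folklore] -/
theorem chain_identity_xa (j : ZMod (2 * n)) :
    Finsupp.single (oflipCM (c n) c_mul_c (xa j) (barc (0 : ZMod (2 * n)) 0)) (1 : ℤ) -
        Finsupp.single (rt (c n) (a 1) (oflipCM (c n) c_mul_c (xa (j + 1)) (barc 0 0))) 1 =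
      (Finsupp.single (barc (0 : ZMod (2 * n)) 0) (1 : ℤ) - Finsupp.single (rt (c n) (a 1) (barc 0 0)) 1) -
        gface (c n) c_mul_c (barc 0 0) (xa j) (xa (-1)) +
          Finsupp.mapDomain (rt (c n) (a 1)) (gface (c n) c_mul_c (barc 0 0) (a 0) (xa (j + 1))) := by
  rw [gface, gface]
  simp only [Finsupp.mapDomain_add, Finsupp.mapDomain_sub, Finsupp.mapDomain_single]
  rw [rt_a_one_oflip_a_zero_xa, rt_a_one_oflip_a_zero]
  abel

/-- The top of the reflection chain: the face `f'_{n−2} = gface T₀ (xa (n−2)) (xa (−1))` has, besides `V_{n−2}`, only biarc corners: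
`f'_{n−2} = [T₀] + [barc 0 (−2)] − [V_{n−2}] − [barc 0 (−1)]`. [folklore] -/
theorem gface_top_xa : gface (c n) c_mul_c (barc (0 : ZMod (2 * n)) 0) (xa ((n : ZMod (2 * n)) - 2)) (xa (-1)) =
    Finsupp.single (barc (0 : ZMod (2 * n)) 0) 1 + Finsupp.single (barc 0 (-2)) 1 -
      Finsupp.single (oflipCM (c n) c_mul_c (xa ((n : ZMod (2 * n)) - 2)) (barc 0 0)) 1 - Finsupp.single (barc 0 (-1)) 1 := by
  have hc : (xa ((n : ZMod (2 * n)) - 2) : QuaternionGroup n) = c n * xa (-2) := by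
    rw [(c_mul_a (-2)).2]; congr 1; ring
  have h2 : oflipCM (c n) c_mul_c (xa ((n : ZMod (2 * n)) - 2)) (barc (0 : ZMod (2 * n)) (-1)) = barc 0 (-2) := by
    rw [hc, oflipCM_cmul, show (-2 : ZMod (2 * n)) = -1 - 1 by ring, oflipCM_xa_last_barc]
  rw [gface, oflipCM_ends.2.2.2, h2]

/-! ## §3 The reductions in the target lattice -/

section Target

variable (S : Finset (CMF (QuaternionGroup n) (c n) →₀ ℤ)) (hS : ∀ k : ℕ, k < n → fplus (k : ZMod (2 * n)) 0 ∈ S)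

/-- `[T₀] − [T₀·(a 1)⁻¹]` lies in the target lattice. [folklore] -/
theorem single_base_sub_mem_target :
    Finsupp.single (barc (0 : ZMod (2 * n)) 0) (1 : ℤ) - Finsupp.single (rt (c n) (a 1) (barc 0 0)) 1 ∈
      (Submodule.span ℤ (pairSet (c n)) ⊔ Submodule.span ℤ (translates (c n) S)) ⊔
        Submodule.span ℤ (Set.range fun Q : QuaternionGroup n => Finsupp.single (rt (c n) Q (barc 0 0)) (1 : ℤ)) :=
  Submodule.sub_mem _ (single_base_mem_target (c n) S _) (single_rt_mem_target (c n) S _ _)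

/-- **One link of the rotation chain**: if `f_i, c_i ∈ S` then `[U_i] − [U_{i+1}·(a 1)⁻¹] ∈ 𝓣(S, T₀)`. [folklore] -/
theorem link_a_mem_target (i : ZMod (2 * n)) (hf : gface (c n) c_mul_c (barc 0 0) (a i) (xa (-1)) ∈ S)
    (hc : gface (c n) c_mul_c (barc 0 0) (a 0) (a (i + 1)) ∈ S) :
    Finsupp.single (oflipCM (c n) c_mul_c (a i) (barc (0 : ZMod (2 * n)) 0)) (1 : ℤ) -
        Finsupp.single (rt (c n) (a 1) (oflipCM (c n) c_mul_c (a (i + 1)) (barc 0 0))) 1 ∈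
      (Submodule.span ℤ (pairSet (c n)) ⊔ Submodule.span ℤ (translates (c n) S)) ⊔
        Submodule.span ℤ (Set.range fun Q : QuaternionGroup n => Finsupp.single (rt (c n) Q (barc 0 0)) (1 : ℤ)) := by
  rw [chain_identity_a]
  refine Submodule.add_mem _ (Submodule.sub_mem _ (single_base_sub_mem_target S) ?_) (mapDomain_rt_mem_target_of_mem (c n) S _ _ hc)
  have h := mapDomain_rt_mem_target_of_mem (c n) S (barc 0 0) 1 hf
  rwa [show rt (c n) (1 : QuaternionGroup n) = id from funext (rt_one (c n)), Finsupp.mapDomain_id] at h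

/-- **One link of the reflection chain**: if `f'_j, c'_j ∈ S` then `[V_j] − [V_{j+1}·(a 1)⁻¹] ∈ 𝓣(S, T₀)`. [folklore] -/
theorem link_xa_mem_target (j : ZMod (2 * n)) (hf : gface (c n) c_mul_c (barc 0 0) (xa j) (xa (-1)) ∈ S)
    (hc : gface (c n) c_mul_c (barc 0 0) (a 0) (xa (j + 1)) ∈ S) :
    Finsupp.single (oflipCM (c n) c_mul_c (xa j) (barc (0 : ZMod (2 * n)) 0)) (1 : ℤ) -
        Finsupp.single (rt (c n) (a 1) (oflipCM (c n) c_mul_c (xa (j + 1)) (barc 0 0))) 1 ∈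
      (Submodule.span ℤ (pairSet (c n)) ⊔ Submodule.span ℤ (translates (c n) S)) ⊔
        Submodule.span ℤ (Set.range fun Q : QuaternionGroup n => Finsupp.single (rt (c n) Q (barc 0 0)) (1 : ℤ)) := by
  rw [chain_identity_xa]
  refine Submodule.add_mem _ (Submodule.sub_mem _ (single_base_sub_mem_target S) ?_) (mapDomain_rt_mem_target_of_mem (c n) S _ _ hc)
  have h := mapDomain_rt_mem_target_of_mem (c n) S (barc 0 0) 1 hf
  rwa [show rt (c n) (1 : QuaternionGroup n) = id from funext (rt_one (c n)), Finsupp.mapDomain_id] at h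

/-- **Descending one link**: `2·[Ψ'] ∈ 𝓣` and `[Ψ] − [Ψ'·(a 1)⁻¹] ∈ 𝓣` give `2·[Ψ] ∈ 𝓣`. [folklore] -/
theorem two_smul_mem_of_link {Ψ Ψ' : CMF (QuaternionGroup n) (c n)}
    (hlink : Finsupp.single Ψ (1 : ℤ) - Finsupp.single (rt (c n) (a 1) Ψ') 1 ∈
      (Submodule.span ℤ (pairSet (c n)) ⊔ Submodule.span ℤ (translates (c n) S)) ⊔
        Submodule.span ℤ (Set.range fun Q : QuaternionGroup n => Finsupp.single (rt (c n) Q (barc 0 0)) (1 : ℤ)))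
    (h' : (2 : ℤ) • Finsupp.single Ψ' (1 : ℤ) ∈
      (Submodule.span ℤ (pairSet (c n)) ⊔ Submodule.span ℤ (translates (c n) S)) ⊔
        Submodule.span ℤ (Set.range fun Q : QuaternionGroup n => Finsupp.single (rt (c n) Q (barc 0 0)) (1 : ℤ))) :
    (2 : ℤ) • Finsupp.single Ψ (1 : ℤ) ∈
      (Submodule.span ℤ (pairSet (c n)) ⊔ Submodule.span ℤ (translates (c n) S)) ⊔
        Submodule.span ℤ (Set.range fun Q : QuaternionGroup n => Finsupp.single (rt (c n) Q (barc 0 0)) (1 : ℤ)) := by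
  have h2 := smul_single_rt_mem_target (c n) S (barc 0 0) c_comm (a 1) 2 h'
  have e : (2 : ℤ) • Finsupp.single Ψ (1 : ℤ) =
      (2 : ℤ) • (Finsupp.single Ψ (1 : ℤ) - Finsupp.single (rt (c n) (a 1) Ψ') 1) + (2 : ℤ) • Finsupp.single (rt (c n) (a 1) Ψ') 1 := by
    rw [smul_sub, sub_add_cancel]
  rw [e]
  exact Submodule.add_mem _ (Submodule.smul_mem _ _ hlink) h2

include hS in
/-- **THE ROTATION CHAIN**: with the biarc faces and the chain faces `f_i, c_i` (`1 ≤ i ≤ n−2`) in `S`, every `U_{n−1−k} = T₀^{(a (n−1−k))}`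
(`k ≤ n−2`) has `2·[U] ∈ 𝓣(S, T₀)` — downward from the biarc `U_{n−1} = barc (−1) 0`. [folklore] -/
theorem two_smul_single_oflip_a_down (hSf : ∀ i : ℕ, 1 ≤ i → i + 2 ≤ n → gface (c n) c_mul_c (barc 0 0) (a (i : ZMod (2 * n))) (xa (-1)) ∈ S)
    (hSc : ∀ i : ℕ, 1 ≤ i → i + 2 ≤ n → gface (c n) c_mul_c (barc 0 0) (a 0) (a ((i : ZMod (2 * n)) + 1)) ∈ S) :
    ∀ k : ℕ, k + 2 ≤ n → (2 : ℤ) • Finsupp.single (oflipCM (c n) c_mul_c (a ((n : ZMod (2 * n)) - 1 - k)) (barc (0 : ZMod (2 * n)) 0)) (1 : ℤ) ∈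
      (Submodule.span ℤ (pairSet (c n)) ⊔ Submodule.span ℤ (translates (c n) S)) ⊔
        Submodule.span ℤ (Set.range fun Q : QuaternionGroup n => Finsupp.single (rt (c n) Q (barc 0 0)) (1 : ℤ)) := by
  intro k
  induction k with
  | zero =>
    intro _
    have e : (a ((n : ZMod (2 * n)) - 1 - ((0 : ℕ) : ZMod (2 * n))) : QuaternionGroup n) = c n * a (-1) := by
      rw [(c_mul_a (-1)).1, Nat.cast_zero, sub_zero]; congr 1; ring
    rw [e, oflipCM_cmul, oflipCM_ends.2.1]
    exact two_smul_single_barc_mem_target S hS _ _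
  | succ k ih =>
    intro hk
    have hn : 1 ≤ n - 2 - k ∧ n - 2 - k + 2 ≤ n := ⟨by omega, by omega⟩
    have hcast : ((n - 2 - k : ℕ) : ZMod (2 * n)) = (n : ZMod (2 * n)) - 1 - ((k + 1 : ℕ) : ZMod (2 * n)) := by
      rw [Nat.cast_sub (by omega), Nat.cast_sub (by omega)]; push_cast; ring
    have hlink := link_a_mem_target S _ (hSf _ hn.1 hn.2) (hSc _ hn.1 hn.2)
    rw [hcast] at hlink
    refine two_smul_mem_of_link S hlink ?_
    rw [show (n : ZMod (2 * n)) - 1 - ((k + 1 : ℕ) : ZMod (2 * n)) + 1 = (n : ZMod (2 * n)) - 1 - (k : ℕ) by push_cast; ring]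
    exact ih (by omega)

include hS in
/-- **Every rotation flip of `T₀` reduces with exponent one**: `2·[T₀^{(a i)}] ∈ 𝓣(S, T₀)` for `i < n`. [folklore] -/
theorem two_smul_single_oflip_a (hSf : ∀ i : ℕ, 1 ≤ i → i + 2 ≤ n → gface (c n) c_mul_c (barc 0 0) (a (i : ZMod (2 * n))) (xa (-1)) ∈ S)
    (hSc : ∀ i : ℕ, 1 ≤ i → i + 2 ≤ n → gface (c n) c_mul_c (barc 0 0) (a 0) (a ((i : ZMod (2 * n)) + 1)) ∈ S)
    (i : ℕ) (hi : i < n) :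
    (2 : ℤ) • Finsupp.single (oflipCM (c n) c_mul_c (a (i : ZMod (2 * n))) (barc (0 : ZMod (2 * n)) 0)) (1 : ℤ) ∈
      (Submodule.span ℤ (pairSet (c n)) ⊔ Submodule.span ℤ (translates (c n) S)) ⊔
        Submodule.span ℤ (Set.range fun Q : QuaternionGroup n => Finsupp.single (rt (c n) Q (barc 0 0)) (1 : ℤ)) := by
  rcases Nat.eq_zero_or_pos i with rfl | hi0
  · rw [Nat.cast_zero, oflipCM_ends.1]
    exact two_smul_single_barc_mem_target S hS _ _
  · have h := two_smul_single_oflip_a_down S hS hSf hSc (n - 1 - i) (by omega)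
    rwa [show (n : ZMod (2 * n)) - 1 - ((n - 1 - i : ℕ) : ZMod (2 * n)) = (i : ℕ) by
      rw [Nat.cast_sub (by omega), Nat.cast_sub (by omega)]; push_cast; ring] at h

include hS in
/-- **THE REFLECTION CHAIN**, top link included: with the biarc faces, `f'_j` (`1 ≤ j ≤ n−2`) and `c'_j` (`1 ≤ j ≤ n−3`) in `S`, every
`V_{n−2−k} = T₀^{(xa (n−2−k))}` (`k ≤ n−3`) has `2·[V] ∈ 𝓣(S, T₀)` — downward from `V_{n−2}`, whose face `f'_{n−2}` has biarc corners only.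
[folklore] -/
theorem two_smul_single_oflip_xa_down
    (hSf : ∀ j : ℕ, 1 ≤ j → j + 2 ≤ n → gface (c n) c_mul_c (barc 0 0) (xa (j : ZMod (2 * n))) (xa (-1)) ∈ S)
    (hSc : ∀ j : ℕ, 1 ≤ j → j + 3 ≤ n → gface (c n) c_mul_c (barc 0 0) (a 0) (xa ((j : ZMod (2 * n)) + 1)) ∈ S) :
    ∀ k : ℕ, k + 3 ≤ n → (2 : ℤ) • Finsupp.single (oflipCM (c n) c_mul_c (xa ((n : ZMod (2 * n)) - 2 - k)) (barc (0 : ZMod (2 * n)) 0)) (1 : ℤ) ∈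
      (Submodule.span ℤ (pairSet (c n)) ⊔ Submodule.span ℤ (translates (c n) S)) ⊔
        Submodule.span ℤ (Set.range fun Q : QuaternionGroup n => Finsupp.single (rt (c n) Q (barc 0 0)) (1 : ℤ)) := by
  intro k
  induction k with
  | zero =>
    intro hk
    -- the top: `2[V_{n−2}] = 2[T₀] + 2[barc 0 (−2)] − 2[barc 0 (−1)] − 2 f'_{n−2}`
    have hf := hSf (n - 2) (by omega) (by omega)
    have hcast : ((n - 2 : ℕ) : ZMod (2 * n)) = (n : ZMod (2 * n)) - 2 := by rw [Nat.cast_sub (by omega)]; push_cast; ring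
    rw [hcast] at hf
    have hfT := mapDomain_rt_mem_target_of_mem (c n) S (barc 0 0) 1 hf
    rw [show rt (c n) (1 : QuaternionGroup n) = id from funext (rt_one (c n)), Finsupp.mapDomain_id, gface_top_xa] at hfT
    rw [Nat.cast_zero, sub_zero]
    have e : (2 : ℤ) • Finsupp.single (oflipCM (c n) c_mul_c (xa ((n : ZMod (2 * n)) - 2)) (barc (0 : ZMod (2 * n)) 0)) (1 : ℤ) =
        (2 : ℤ) • Finsupp.single (barc (0 : ZMod (2 * n)) 0) (1 : ℤ) + (2 : ℤ) • Finsupp.single (barc (0 : ZMod (2 * n)) (-2)) (1 : ℤ) -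
          (2 : ℤ) • Finsupp.single (barc (0 : ZMod (2 * n)) (-1)) (1 : ℤ) -
          (2 : ℤ) • (Finsupp.single (barc (0 : ZMod (2 * n)) 0) 1 + Finsupp.single (barc 0 (-2)) 1 -
            Finsupp.single (oflipCM (c n) c_mul_c (xa ((n : ZMod (2 * n)) - 2)) (barc 0 0)) 1 - Finsupp.single (barc 0 (-1)) 1) := by
      simp only [smul_add, smul_sub]; abel
    rw [e]
    exact Submodule.sub_mem _ (Submodule.sub_mem _ (Submodule.add_mem _ (two_smul_single_barc_mem_target S hS _ _)
      (two_smul_single_barc_mem_target S hS _ _)) (two_smul_single_barc_mem_target S hS _ _)) (Submodule.smul_mem _ _ hfT)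
  | succ k ih =>
    intro hk
    have hn : 1 ≤ n - 3 - k ∧ n - 3 - k + 2 ≤ n ∧ n - 3 - k + 3 ≤ n := ⟨by omega, by omega, by omega⟩
    have hcast : ((n - 3 - k : ℕ) : ZMod (2 * n)) = (n : ZMod (2 * n)) - 2 - ((k + 1 : ℕ) : ZMod (2 * n)) := by
      rw [Nat.cast_sub (by omega), Nat.cast_sub (by omega)]; push_cast; ring
    have hlink := link_xa_mem_target S _ (hSf _ hn.1 hn.2.1) (hSc _ hn.1 hn.2.2)
    rw [hcast] at hlink
    refine two_smul_mem_of_link S hlink ?_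
    rw [show (n : ZMod (2 * n)) - 2 - ((k + 1 : ℕ) : ZMod (2 * n)) + 1 = (n : ZMod (2 * n)) - 2 - (k : ℕ) by push_cast; ring]
    exact ih (by omega)

include hS in
/-- **Every reflection flip of `T₀` reduces with exponent one**: `2·[T₀^{(xa j)}] ∈ 𝓣(S, T₀)` for `j < n`. [folklore] -/
theorem two_smul_single_oflip_xa
    (hSf : ∀ j : ℕ, 1 ≤ j → j + 2 ≤ n → gface (c n) c_mul_c (barc 0 0) (xa (j : ZMod (2 * n))) (xa (-1)) ∈ S)
    (hSc : ∀ j : ℕ, 1 ≤ j → j + 3 ≤ n → gface (c n) c_mul_c (barc 0 0) (a 0) (xa ((j : ZMod (2 * n)) + 1)) ∈ S)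
    (j : ℕ) (hj : j < n) :
    (2 : ℤ) • Finsupp.single (oflipCM (c n) c_mul_c (xa (j : ZMod (2 * n))) (barc (0 : ZMod (2 * n)) 0)) (1 : ℤ) ∈
      (Submodule.span ℤ (pairSet (c n)) ⊔ Submodule.span ℤ (translates (c n) S)) ⊔
        Submodule.span ℤ (Set.range fun Q : QuaternionGroup n => Finsupp.single (rt (c n) Q (barc 0 0)) (1 : ℤ)) := by
  rcases Nat.eq_zero_or_pos j with rfl | hj0
  · rw [Nat.cast_zero, oflipCM_ends.2.2.1]
    exact two_smul_single_barc_mem_target S hS _ _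
  · by_cases hjn : j = n - 1
    · subst hjn
      have e : (xa ((n - 1 : ℕ) : ZMod (2 * n)) : QuaternionGroup n) = c n * xa (-1) := by
        rw [(c_mul_a (-1)).2, Nat.cast_sub (by omega)]; push_cast; congr 1; ring
      rw [e, oflipCM_cmul, oflipCM_ends.2.2.2]
      exact two_smul_single_barc_mem_target S hS _ _
    · have h := two_smul_single_oflip_xa_down S hS hSf hSc (n - 2 - j) (by omega)
      rwa [show (n : ZMod (2 * n)) - 2 - ((n - 2 - j : ℕ) : ZMod (2 * n)) = (j : ℕ) by
        rw [Nat.cast_sub (by omega), Nat.cast_sub (by omega)]; push_cast; ring] at h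

include hS in
/-- **COMPLETE RESIDUAL REDUCTION OF THE QUATERNION COLUMN, exponent one.**  `S` containing the biarc faces and the chain faces `⟹` every type
of potential `≤ 1` w.r.t. `T₀ = barc 0 0` satisfies `2·[Ψ] ∈ ℤ⟨pairs⟩ + ℤ⟨base changes of S⟩ + ℤ⟨base changes of [T₀]⟩` (the hypothesis
`hres`, `k = 1`, of `Splitting.isLeast_card_gfaces_generate_of_residual_reduction`). [folklore] -/
theorem residual_reduction_quaternion
    (hSf : ∀ i : ℕ, 1 ≤ i → i + 2 ≤ n → gface (c n) c_mul_c (barc 0 0) (a (i : ZMod (2 * n))) (xa (-1)) ∈ S)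
    (hSc : ∀ i : ℕ, 1 ≤ i → i + 2 ≤ n → gface (c n) c_mul_c (barc 0 0) (a 0) (a ((i : ZMod (2 * n)) + 1)) ∈ S)
    (hSf' : ∀ j : ℕ, 1 ≤ j → j + 2 ≤ n → gface (c n) c_mul_c (barc 0 0) (xa (j : ZMod (2 * n))) (xa (-1)) ∈ S)
    (hSc' : ∀ j : ℕ, 1 ≤ j → j + 3 ≤ n → gface (c n) c_mul_c (barc 0 0) (a 0) (xa ((j : ZMod (2 * n)) + 1)) ∈ S) :
    ∀ Ψ : CMF (QuaternionGroup n) (c n), bpot (c n) (barc 0 0) Ψ ≤ 1 → ((2 : ℤ) ^ 1) • Finsupp.single Ψ (1 : ℤ) ∈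
      (Submodule.span ℤ (pairSet (c n)) ⊔ Submodule.span ℤ (translates (c n) S)) ⊔
        Submodule.span ℤ (Set.range fun Q : QuaternionGroup n => Finsupp.single (rt (c n) Q (barc 0 0)) (1 : ℤ)) := by
  refine residual_reduction_of_single_flips (c n) (barc 0 0) c_mul_c c_comm S 1 fun s hs => ?_
  rw [pow_one]
  cases s with
  | a i =>
    rw [a_mem_barc, sub_zero] at hs
    have h := two_smul_single_oflip_a S hS hSf hSc i.val hs
    rwa [ZMod.natCast_zmod_val] at h
  | xa j =>
    rw [xa_mem_barc, sub_zero] at hs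
    have h := two_smul_single_oflip_xa S hS hSf' hSc' j.val hs
    rwa [ZMod.natCast_zmod_val] at h

end Target

end

end Summit.HodgeConjecture.CorCM.Census.QuaternionColumn
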